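import Summits.QuantumFields.YangMills.Theorems.BalabanUVNodesN11FluctTruncationDefs
import Summits.QuantumFields.YangMills.Theorems.BalabanUVNodesN11NoExpansionGeneralStepRePinnedIntegrable

/-!
# DAG node N11 — THE §2 LAWS OF RECORD HAVE `k`-LOCAL WITNESSES (fluctuation truncation changes nothing `𝐓_k(s)` reads), HENCE THE BINDER (hA) OF THE
# GENERAL NO-EXPANSION 𝐓-STEP IS DISCHARGED FROM `SLaw` ALONE

HEADER — WORK-UNIT METADATA.  Cell `pub-ymgap`, YM-PLAN Track A (HUMAN RULING D-0062), seat `pub-ymgap-dag-n11-d` (g10; R134 fan-out seat N11 [B14], strategy s2),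
route `BalabanUVNodes` rev 25, item K1⁷ `StabilityBAtRecordR13SepCoPH` = stmt-QuantumFields-20542 (helper, `--kind proof --supports 20542 --as helper`, count-neutral).
[III] = [Balaban1988Convergent].  Over `…N11FluctTruncationDefs` (g10: `truncMSFluct`, `truncTermValues`, `IsFluctLocal`, law transport), 11a `Node00.TkOfRecord`
(`genOp`, `tkBranchOfRecord`, `TkOfRecord`, `baseCfg`), 11c `Node00.Sect2FormOfRecord` (`sect2Slot`), def-T's v1.7 record `Node00.Record13CoPH` (`HasSect2FormAtZS ∕ AEZS ∕ TAEZS`,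
`sLaw₁₃CoPH_iff`, `tLaw₁₃CoPH_iff`) this seat's g9 file D `…N11NoExpansionGeneralStepRePinnedIntegrable` (p569094).

WHY THIS FILE.  D's ★★★ `exists_clause_succ_rePinH_of_Omega_empty_of_sLaw₁₃CoPH_of_termLaws` states the off-diagonal residue of N11's no-expansion 𝐓-step with
three binders on the §2 term data at the old sequence (referee READ-733: «exactly {hA, hΦm, hIB}»).  THIS FILE ELIMINATES (hA) — the `k`-locality of the (2.23)
action in the fluctuation argument — WITHOUT any new law of record: 11a's `𝐓_k(s)` evaluates its operand only at all-scales configurations whose fluctuation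
variables VANISH above the integrated generations (`baseCfg_snd`; generation `j` updates scale `j` only), so replacing a witness `t` by its truncation
`truncTermValues k t` (Defs) changes NO value of the §2 slot (§2, pointwise), keeps every law (Defs §3), and is `k`-local by construction.  Hence the §2 laws of
record have `k`-local witnesses (§3), and the 𝐓-step holds with (hA) gone (§4) — stated PER WITNESS: the two analytic binders (old-branch measurability hmB ∕
integrability hIB; the sibling `…N11NoExpansionOldBranchGraph` then drops hmB) are asked of the produced witness itself, never of «all term families» (the `∀ t₀` shape of D's ∃-form is avoided on purpose: such binders are
unsatisfiable as soon as one law-abiding family is wild off the spaces of record).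

WHAT THIS FILE PROVES (0 `sorry`, 0 `def`; §1–§3 generic in `N`, the fluctuation space `V`, the weights `W`).
§1 RELATIONAL CONGRUENCE of 11a's operator algebra (common generalisation of p527289's (SL) and of «two operands agreeing on an invariant set»):
   `genOp_congr_rel`, ★ `tkBranchOfRecord_congr_rel`, `tkBranchOfRecord_congr_on_fluctFree`, `TkOfRecord_congr_on_fluctFree` (level `n ≤ k+1`).
§2 ★ `sect2Slot_truncTermValues`: `sect2Slot … s (truncTermValues k t) E U = sect2Slot … s t E U` for every sequence of length `n ≤ k+1` (POINTWISE).
§3 `hasSect2FormAtZS_truncTermValues`; ★★ `hasSect2FormAEZS_iff_exists_local`, `hasSect2FormTAEZS_iff_exists_local`; at the record ★★ `sLaw₁₃CoPH_iff_exists_local`,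
   `tLaw₁₃CoPH_iff_exists_local` — the 𝐒∕𝐓 laws of record hold iff they hold with a witness family ALL of whose members are `k`-local.
§4 `clause_succ_rePinH_of_Omega_empty_of_isFluctLocal_of_clause_of_integrable` (D's first theorem, (hA) ↦ `IsFluctLocal`); ★★★
   `clause_succ_rePinH_truncTermValues_of_Omega_empty_of_clause_of_integrable` (ANY `t`: identity for `t` at `init s′` ⇒ clause for `truncTermValues k t` at `s′`, no
   locality binder); ★★★ `exists_local_witness_clause_succ_rePinH_of_sLaw₁₃CoPH`: `SLaw`-keyed, WITNESS FIRST, the two remaining binders (hmB old-branch measurability, hIB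
   old-branch integrability) about it.  The sibling `…N11NoExpansionOldBranchGraph` (door (d2)) drops hmB: the joint law is carried by the averaging graph.

HONEST FRAMING.  Helper lane of K1⁷; kernel bookkeeping over the tree's own operators and records; nothing of Bałaban's estimates is asserted; no law of record is
edited or posited.  The residue of N11's no-expansion 𝐓-step off the diagonal is now: old-branch measurability + integrability OF THE `SLaw` WITNESS (both hold on the
all-large diagonal, p556687 ∕ p563687), and the sibling graph file removes the measurability half; sequences with `Ω_{k+1}(s′) ≠ ∅` are [III] §3 + Thm 2 proper (𝐑), not this lane's.  N11 NOT discharged; K1⁷ NOT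
closed; counts unmoved (typed 28∕28 · discharged 5∕27).  One finite four-torus programme at fixed `ε = L^{−K}` — NOT ℝ⁴, NOT OS, NOT a mass gap, NOT Clay.
No `sorry`, `axiom`, `instance`, `notation`.  Sources (SHAPE only): [III] Theorem p.245, (2.17)–(2.18) p.257, (2.20)–(2.23) p.258, (2.40)–(2.41) p.261, Thm 1 p.262,
(3.24)–(3.25) p.270.
-/

noncomputable section

open MeasureTheory
open scoped BigOperators Matrix.Norms.L2Operator

namespace Summit.QuantumFields.YangMills.Theorems.BalabanUVNodesN11FluctTruncation

open Literature.MathematicalPhysics.QuantumFieldTheory.Balaban1983to89 T4Continuum Node00 Node00.Tk DagBinding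
open B15DeterminingSets
open T4AdjointCovariance (JCfg insA)
open BalabanUVNodesN11FluctTruncationDefs BalabanUVNodesN11RePinnedParamDefs
open BalabanUVNodesN11NoExpansionGeneralStepRePinnedIntegrable (clause_succ_rePinH_of_Omega_empty_of_oldBranch_of_clause_of_integrable)

variable {F : T4Family} {N : ℕ} [NeZero N]

/-! ## §1  Relational congruence of 11a's operator algebra -/

section Congr

variable {V : Type} [NormedAddCommGroup V] [InnerProductSpace ℝ V] [FiniteDimensional ℝ V] [MeasurableSpace V] [BorelSpace V]
variable (ν : Stage7Numerics) (M : ℕ) (g : ℕ → ℝ) (K : ℕ) (W : TkWeights F N V K)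

omit [NeZero N] in
/-- **ONE GENERATION RESPECTS A RELATION ITS DATA RESPECT**: if `R ω ω′` forces agreement of the scale-`j` variables and of the scale-`(j+1)` gauge variables, is
stable under the same update at scale `j`, and is respected by the weights `ζ`, `w` and by the pair of operands `(Φ, Φ′)`, then `𝐓^{(j)}Φ ω = 𝐓^{(j)}Φ′ ω′`
(generation `j` reads the configuration through exactly these). [cite: Balaban1988Convergent, (2.21) p.258] -/
theorem genOp_congr_rel {j : ℕ} {hdec : DecidableEq (PBond (F.P K) j)} (D : GenData (F.P K) (SU N) V j)
    (R : MultiCfg (F.P K) (SU N) V → MultiCfg (F.P K) (SU N) V → Prop)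
    (hRj : ∀ ω ω', R ω ω' → ω j = ω' j) (hRj1 : ∀ ω ω', R ω ω' → (ω (j + 1)).1 = (ω' (j + 1)).1)
    (hRupd : ∀ ω ω', R ω ω' → ∀ c : JCfg (F.P K) j (SU N) V, R (Function.update ω j c) (Function.update ω' j c))
    (hζ : ∀ ω ω', R ω ω' → D.ζ ω = D.ζ ω') (hw : ∀ ω ω', R ω ω' → D.w ω = D.w ω')
    {Φ Φ' : MultiCfg (F.P K) (SU N) V → ℝ} (hΦ : ∀ ω ω', R ω ω' → Φ ω = Φ' ω')
    (ω ω' : MultiCfg (F.P K) (SU N) V) (h : R ω ω') : genOp j D Φ ω = genOp j D Φ' ω' := by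
  simp only [genOp_apply, vOp_apply]
  rw [hRj ω ω' h, hRj1 ω ω' h]
  congr 1
  funext y
  simp only [zetaOp_apply]
  have h1 : R (Function.update ω j (Function.updateFinset (ω' j).1 D.sV y, (ω' j).2))
      (Function.update ω' j (Function.updateFinset (ω' j).1 D.sV y, (ω' j).2)) := hRupd ω ω' h _
  rw [hζ _ _ h1, aOp_apply, aOp_apply]
  congr 1
  refine integral_congr_ae (Filter.Eventually.of_forall fun a => ?_)
  have hj' : Function.update ω j (Function.updateFinset (ω' j).1 D.sV y, (ω' j).2) j =
      Function.update ω' j (Function.updateFinset (ω' j).1 D.sV y, (ω' j).2) j := by rw [Function.update_self, Function.update_self]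
  have h2 := hRupd _ _ h1 (insA D.sA a (Function.update ω' j (Function.updateFinset (ω' j).1 D.sV y, (ω' j).2) j))
  rw [hj']
  show D.w _ * Φ _ = D.w _ * Φ' _
  rw [hw _ _ h2, hΦ _ _ h2]

/-- **★ THE BRANCH OPERATOR RESPECTS A RELATION ITS GENERATIONS RESPECT, up to generation `m`**: for a relation `R` forcing agreement of the scale-`j` variables and
the scale-`(j+1)` gauge variables (`j < m`), stable under the same update at every scale `j < m`, respected by the weights of the generations `j < m` and by
`(Φ, Φ′)`: `𝐓_i(s,S)Φ ω = 𝐓_i(s,S)Φ′ ω′` whenever `R ω ω′`, `i ≤ m` (p527289's (SL) is the case `R =` «agree on the scales `≤ k`», `Φ′ = Φ`).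
[cite: Balaban1988Convergent, (2.20)–(2.21) p.258, (3.24) p.270] -/
theorem tkBranchOfRecord_congr_rel {n m : ℕ} (s : SeqOfRecord F ν M g K n) (S : ℕ → Set (Site (F.P K) 0))
    (R : MultiCfg (F.P K) (SU N) V → MultiCfg (F.P K) (SU N) V → Prop)
    (hRj : ∀ j, j < m → ∀ ω ω', R ω ω' → ω j = ω' j) (hRj1 : ∀ j, j < m → ∀ ω ω', R ω ω' → (ω (j + 1)).1 = (ω' (j + 1)).1)
    (hRupd : ∀ j, j < m → ∀ ω ω', R ω ω' → ∀ c : JCfg (F.P K) j (SU N) V, R (Function.update ω j c) (Function.update ω' j c))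
    (hζ : ∀ j, j < m → ∀ ω ω', R ω ω' → W.ζ j (s.Ω (j + 1))ᶜ ω = W.ζ j (s.Ω (j + 1))ᶜ ω')
    (hw : ∀ j, j < m → ∀ ω ω', R ω ω' →
      W.w j (s.Λ (j + 1)) ((s.Λ (j + 1))ᶜ ∩ s.Ω (j + 1)) (S (j + 1)) ω = W.w j (s.Λ (j + 1)) ((s.Λ (j + 1))ᶜ ∩ s.Ω (j + 1)) (S (j + 1)) ω')
    {Φ Φ' : MultiCfg (F.P K) (SU N) V → ℝ} (hΦ : ∀ ω ω', R ω ω' → Φ ω = Φ' ω') :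
    ∀ i, i ≤ m → ∀ ω ω', R ω ω' → tkBranchOfRecord F N V ν M g K W s S i Φ ω = tkBranchOfRecord F N V ν M g K W s S i Φ' ω'
  | 0, _, ω, ω', h => hΦ ω ω' h
  | i + 1, hi, ω, ω', h => by
      rw [tkBranchOfRecord_succ, tkBranchOfRecord_succ]
      have hi' : i < m := hi
      exact genOp_congr_rel K _ R (hRj i hi') (hRj1 i hi') (hRupd i hi') (hζ i hi') (hw i hi')
        (fun ω₁ ω₂ h₁₂ => tkBranchOfRecord_congr_rel s S R hRj hRj1 hRupd hζ hw hΦ i (Nat.le_of_succ_le hi) ω₁ ω₂ h₁₂) ω ω' h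

/-- **TWO OPERANDS AGREEING ON THE CONFIGURATIONS WITH NO FLUCTUATION VARIABLES ABOVE SCALE `k` HAVE THE SAME BRANCH IMAGES THERE, up to generation `k+1`**
(the set is stable under the updates of the generations `j ≤ k`). [cite: Balaban1988Convergent, (2.20)–(2.21) p.258, (2.18) p.257] -/
theorem tkBranchOfRecord_congr_on_fluctFree {n m k : ℕ} (hmk : m ≤ k + 1) (s : SeqOfRecord F ν M g K n) (S : ℕ → Set (Site (F.P K) 0))
    {Φ Φ' : MultiCfg (F.P K) (SU N) V → ℝ} (hΦ : ∀ ω : MultiCfg (F.P K) (SU N) V, (∀ i, k < i → (ω i).2 = 0) → Φ ω = Φ' ω) :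
    ∀ i, i ≤ m → ∀ ω : MultiCfg (F.P K) (SU N) V, (∀ i', k < i' → (ω i').2 = 0) →
      tkBranchOfRecord F N V ν M g K W s S i Φ ω = tkBranchOfRecord F N V ν M g K W s S i Φ' ω := by
  intro i hi ω hω
  refine tkBranchOfRecord_congr_rel ν M g K W s S (fun ω ω' => ω = ω' ∧ ∀ i', k < i' → (ω i').2 = 0)
    (fun j _ ω ω' h => by rw [h.1]) (fun j _ ω ω' h => by rw [h.1]) (fun j hj ω ω' h c => ?_)
    (fun j _ ω ω' h => by rw [h.1]) (fun j _ ω ω' h => by rw [h.1]) (fun ω ω' h => by rw [← h.1]; exact hΦ ω h.2) i hi ω ω ⟨rfl, hω⟩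
  refine ⟨by rw [h.1], fun i' hi' => ?_⟩
  have hne : i' ≠ j := by omega
  rw [Function.update_of_ne hne]
  exact h.2 i' hi'

/-- **`𝐓_n(s)` OF RECORD READS ITS OPERAND ONLY AT FLUCTUATION DATA VANISHING ABOVE ANY `k ≥ n − 1`**: two operands of r11's shape agreeing at every datum
`({S_i}, A)` with `A_i = 0` for `i > k` have the same image, `n ≤ k+1` (the base configuration carries `A ≡ 0`, `baseCfg_snd`).
[cite: Balaban1988Convergent, (2.18) p.257, (2.20)–(2.21) p.258] -/
theorem TkOfRecord_congr_on_fluctFree {n k : ℕ} (hnk : n ≤ k + 1) (s : SeqOfRecord F ν M g K n)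
    {Φ Φ' : SFluct (F.P K) V → MSField (F.P K) (SU N) → ℝ}
    (hΦ : ∀ (S : ℕ → Set (Site (F.P K) 0)) (a : MSFluct (F.P K) V) (U : MSField (F.P K) (SU N)), (∀ i, k < i → a i = 0) → Φ (S, a) U = Φ' (S, a) U) :
    TkOfRecord F N V ν M g K W n s Φ = TkOfRecord F N V ν M g K W n s Φ' := by
  funext Vn
  rw [TkOfRecord_apply, TkOfRecord_apply]
  refine Finset.sum_congr rfl fun S _ => ?_
  exact tkBranchOfRecord_congr_on_fluctFree ν M g K W hnk s S (fun ω hω => hΦ S _ _ hω) n le_rfl _ (fun i _ => baseCfg_snd n i Vn)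

end Congr

/-! ## §2  The §2 slot of the truncated term values IS the slot -/

section Slot

variable {V : Type} [NormedAddCommGroup V] [InnerProductSpace ℝ V] [FiniteDimensional ℝ V] [MeasurableSpace V] [BorelSpace V]
  {𝔸 : Type*} [NormedRing 𝔸] [NormedAlgebra ℂ 𝔸] [CompleteSpace 𝔸]

/-- **★ FLUCTUATION TRUNCATION CHANGES NOTHING `𝐓_n(s)` READS**: for a sequence of length `n ≤ k+1`, the §2 slot `𝐓_n(s) exp A_n(s)` of the truncated term values
`truncTermValues k t` IS the slot of `t`, pointwise (11a's operation evaluates the operand at data with `A_i = 0`, `i > k`, where the two operands agree —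
`sect2Operand_truncTermValues_of_fluctFree`). [cite: Balaban1988Convergent, (2.18) p.257, (2.20)–(2.23) p.258, (2.40) p.261] -/
theorem sect2Slot_truncTermValues (K : ℕ) (S : Sect2.Setting 𝔸 (SU N)) (Rz : Sect2.Residual (F.P K) 𝔸) (W : TkWeights F N V K) {ν : Stage7Numerics} {M : ℕ}
    {g : ℕ → ℝ} {n k : ℕ} (hnk : n ≤ k + 1) (s : SeqOfRecord F ν M g K n) (t : Sect2.TermValues (F.P K) 𝔸 V M) (Ek : ℝ) (U : BgMap F N K) :
    sect2Slot F N V K S Rz W s (truncTermValues k t) Ek U = sect2Slot F N V K S Rz W s t Ek U :=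
  TkOfRecord_congr_on_fluctFree ν M g K W hnk s fun S' _ U' ha => sect2Operand_truncTermValues_of_fluctFree K S Rz s t k Ek U S' ha U'

end Slot

/-! ## §3  The §2 predicates over history-indexed data have `k`-local witnesses -/

section Laws

variable {V : Type} [NormedAddCommGroup V] [InnerProductSpace ℝ V] [FiniteDimensional ℝ V] [MeasurableSpace V] [BorelSpace V]
  {𝔸 : Type*} [NormedRing 𝔸] [NormedAlgebra ℂ 𝔸] [CompleteSpace 𝔸]

/-- **TRUNCATING A WITNESS FAMILY OF `HasSect2FormAtZS`** at a scale `k ≥ n − 1`, for a law package the truncation transports: universality of `𝐄` is kept, every law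
is kept, the identity clause is kept because the slot is unchanged (§2). [cite: Balaban1988Convergent, (2.17)–(2.18) p.257, Thm 1 p.262] -/
theorem hasSect2FormAtZS_truncTermValues {K : ℕ} (S : Sect2.Setting 𝔸 (SU N)) {ν : Stage7Numerics} {M : ℕ} {g : ℕ → ℝ} {n k : ℕ} (hnk : n ≤ k + 1)
    (Rz : SeqOfRecord F ν M g K n → Sect2.Residual (F.P K) 𝔸) (W : SeqOfRecord F ν M g K n → TkWeights F N V K) (U : SeqOfRecord F ν M g K n → BgMap F N K)
    (law : SeqOfRecord F ν M g K n → Sect2.TermValues (F.P K) 𝔸 V M → Prop) (slot : SeqOfRecord F ν M g K n → Density (F.P K) n (SU N))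
    (hlaw : ∀ s t, law s t → law s (truncTermValues k t))
    {t : SeqOfRecord F ν M g K n → Sect2.TermValues (F.P K) 𝔸 V M} {Ek : SeqOfRecord F ν M g K n → ℝ} (h : HasSect2FormAtZS F N V K S n Rz W U law slot t Ek) :
    HasSect2FormAtZS F N V K S n Rz W U law slot (fun s => truncTermValues k (t s)) Ek := by
  refine ⟨universalE_truncTermValues h.1 fun _ => k, fun s => ⟨hlaw s _ (h.2 s).1, ?_⟩⟩
  rcases (h.2 s).2 with h0 | hae
  · exact Or.inl h0
  · refine Or.inr ?_
    rw [sect2Slot_truncTermValues K S (Rz s) (W s) hnk s (t s) (Ek s) (U s)]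
    exact hae

/-- **★★ THE §2 FORM AT INDEX `k` HOLDS IFF IT HOLDS WITH A `k`-LOCAL WITNESS FAMILY** (laws `Sect2.LawsRT … k` transport along the truncation, Defs §3).
[cite: Balaban1988Convergent, Thm 1 p.262, (2.23) p.258, (2.40)–(2.41) p.261] -/
theorem hasSect2FormAEZS_iff_exists_local {K : ℕ} (S : Sect2.Setting 𝔸 (SU N)) {ν : Stage7Numerics} {M : ℕ} {g : ℕ → ℝ} (k : ℕ)
    (Rz : SeqOfRecord F ν M g K k → Sect2.Residual (F.P K) 𝔸) (W : SeqOfRecord F ν M g K k → TkWeights F N V K) (U : SeqOfRecord F ν M g K k → BgMap F N K)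
    (slot : SeqOfRecord F ν M g K k → Density (F.P K) k (SU N)) :
    HasSect2FormAEZS F N V K S k Rz W U slot ↔
      ∃ (t : SeqOfRecord F ν M g K k → Sect2.TermValues (F.P K) 𝔸 V M) (Ek : SeqOfRecord F ν M g K k → ℝ),
        HasSect2FormAtZS F N V K S k Rz W U (fun s t => Sect2.LawsRT (sect2TowerOfRecord F N V K S (Rz s) s t) S.lf k) slot t Ek ∧
          ∀ s, IsFluctLocal k (t s) := by
  constructor
  · rintro ⟨t, Ek, h⟩
    exact ⟨fun s => truncTermValues k (t s), Ek,
      hasSect2FormAtZS_truncTermValues S (Nat.le_succ k) Rz W U _ slot (fun s t ht => lawsRT_truncTermValues S (Rz s) s.Ω t S.lf k k ht) h,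
      fun s => isFluctLocal_truncTermValues k (t s)⟩
  · rintro ⟨t, Ek, h, -⟩
    exact ⟨t, Ek, h⟩

/-- **★★ THE §2 FORM OF THE 𝐓-IMAGE (length `k+1`, laws `LawsT … k`) HOLDS IFF IT HOLDS WITH A `k`-LOCAL WITNESS FAMILY** (at level `k+1` the base configuration
still has `A_{k+1} = 0`, so truncation ABOVE `k` is invisible to `𝐓_{k+1}(s′)`). [cite: Balaban1988Convergent, §2 p.262, §3 p.279, (3.24)–(3.25) p.270] -/
theorem hasSect2FormTAEZS_iff_exists_local {K : ℕ} (S : Sect2.Setting 𝔸 (SU N)) {ν : Stage7Numerics} {M : ℕ} {g : ℕ → ℝ} (k : ℕ)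
    (Rz : SeqOfRecord F ν M g K (k + 1) → Sect2.Residual (F.P K) 𝔸) (W : SeqOfRecord F ν M g K (k + 1) → TkWeights F N V K)
    (U : SeqOfRecord F ν M g K (k + 1) → BgMap F N K) (slotT : SeqOfRecord F ν M g K (k + 1) → Density (F.P K) (k + 1) (SU N)) :
    HasSect2FormTAEZS F N V K S k Rz W U slotT ↔
      ∃ (t : SeqOfRecord F ν M g K (k + 1) → Sect2.TermValues (F.P K) 𝔸 V M) (Ek : SeqOfRecord F ν M g K (k + 1) → ℝ),
        HasSect2FormAtZS F N V K S (k + 1) Rz W U (fun s t => Sect2.LawsT (sect2TowerOfRecord F N V K S (Rz s) s t) S.lf S.βc k) slotT t Ek ∧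
          ∀ s, IsFluctLocal k (t s) := by
  constructor
  · rintro ⟨t, Ek, h⟩
    exact ⟨fun s => truncTermValues k (t s), Ek,
      hasSect2FormAtZS_truncTermValues S le_rfl Rz W U _ slotT (fun s t ht => lawsT_truncTermValues S (Rz s) s.Ω t S.lf S.βc k k ht) h,
      fun s => isFluctLocal_truncTermValues k (t s)⟩
  · rintro ⟨t, Ek, h, -⟩
    exact ⟨t, Ek, h⟩

end Laws

section Record

variable (θ : Stage13HParams F N) (p : B12.RunParams)

/-- **★★ `SLaw₁₃CoPH θ p k` HAS A `k`-LOCAL WITNESS FAMILY** (and conversely, trivially): the 𝐒-law of record at level `k` holds iff the post-𝐑 slot family has the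
§2 form with term values ALL of whose members are `k`-local in the fluctuation variables. [cite: Balaban1988Convergent, (2.18) p.257, Thm 1 p.262, (2.40)–(2.41) p.261] -/
theorem sLaw₁₃CoPH_iff_exists_local (k : ℕ) :
    SLaw₁₃CoPH F N θ p k ↔
      ∃ (t : SeqOfRecord F θ.ν θ.τ9.M (gOfRecord₁₃ F N θ.toStage13Params p) p.K k → Sect2.TermValues (F.P p.K) (MatA N) (FluctV N) θ.τ9.M)
        (Ek : SeqOfRecord F θ.ν θ.τ9.M (gOfRecord₁₃ F N θ.toStage13Params p) p.K k → ℝ),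
        HasSect2FormAtZS F N (FluctV N) p.K (settingOfRecord₁₃ F N θ.toStage13Params p) k (θ.rzAt p) (WtOfRecord₁₃H F N θ p)
            (UbgOfRecord₁₃CoP F N θ.toStage13Params p k)
            (fun s t => Sect2.LawsRT (sect2TowerOfRecord F N (FluctV N) p.K (settingOfRecord₁₃ F N θ.toStage13Params p) (θ.rzAt p s) s t)
              (settingOfRecord₁₃ F N θ.toStage13Params p).lf k)
            (slotsOfRecord F N θ.ν θ.τ9 (EOfRecord₁₃ F N θ.toStage13Params) (wOfRecord₉ F N θ.toStage9Params) θ.ppSel p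
              (gOfRecord₁₃ F N θ.toStage13Params p) k) t Ek ∧
          ∀ s, IsFluctLocal k (t s) :=
  (sLaw₁₃CoPH_iff F N θ p k).trans (hasSect2FormAEZS_iff_exists_local _ k _ _ _ _)

/-- **`TLaw₁₃CoPH θ p k` HAS A `k`-LOCAL WITNESS FAMILY** (and conversely). [cite: Balaban1988Convergent, remark p.262, Def. p.279, (3.25) p.270, (2.40)–(2.41) p.261] -/
theorem tLaw₁₃CoPH_iff_exists_local (k : ℕ) :
    TLaw₁₃CoPH F N θ p k ↔
      ∃ (t : SeqOfRecord F θ.ν θ.τ9.M (gOfRecord₁₃ F N θ.toStage13Params p) p.K (k + 1) → Sect2.TermValues (F.P p.K) (MatA N) (FluctV N) θ.τ9.M)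
        (Ek : SeqOfRecord F θ.ν θ.τ9.M (gOfRecord₁₃ F N θ.toStage13Params p) p.K (k + 1) → ℝ),
        HasSect2FormAtZS F N (FluctV N) p.K (settingOfRecord₁₃ F N θ.toStage13Params p) (k + 1) (θ.rzAt p) (WtOfRecord₁₃H F N θ p)
            (UbgOfRecord₁₃CoP F N θ.toStage13Params p (k + 1))
            (fun s t => Sect2.LawsT (sect2TowerOfRecord F N (FluctV N) p.K (settingOfRecord₁₃ F N θ.toStage13Params p) (θ.rzAt p s) s t)
              (settingOfRecord₁₃ F N θ.toStage13Params p).lf (settingOfRecord₁₃ F N θ.toStage13Params p).βc k)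
            (slotsTOfRecord F N θ.ν θ.τ9 (EOfRecord₁₃ F N θ.toStage13Params) (wOfRecord₉ F N θ.toStage9Params) θ.ppSel p
              (gOfRecord₁₃ F N θ.toStage13Params p) (k + 1)) t Ek ∧
          ∀ s, IsFluctLocal k (t s) :=
  (tLaw₁₃CoPH_iff F N θ p k).trans (hasSect2FormTAEZS_iff_exists_local _ k _ _ _ _)

end Record

/-! ## §4  ★★★ D's off-diagonal residue with (hA) eliminated — PER-WITNESS forms (no binder quantifies over all term families) -/

section RePinned

variable (θ : Stage13HParams F N) (p : B12.RunParams)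

/-- Abbreviation-free restatement of p569094's first theorem with (hA) replaced by `IsFluctLocal k t`: **THE GENERAL-HISTORY NO-EXPANSION 𝐓-STEP AT `rePinH θ` FOR A
`k`-LOCAL WITNESS**, old-branch measurability `hmB` and integrability `hIB` displayed for THIS witness. [cite: Balaban1988Convergent, Theorem p.245, (3.24)–(3.25) p.270, (2.23) p.258, (2.40)–(2.41) p.261] -/
theorem clause_succ_rePinH_of_Omega_empty_of_isFluctLocal_of_clause_of_integrable (h : θ.Provisos₁₃CoPH F N) {k : ℕ} (hk : k < p.K) (hM : 1 ≤ θ.τ9.M)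
    (s : SeqOfRecord F θ.ν θ.τ9.M (gOfRecord₁₃ F N θ.toStage13Params p) p.K (k + 1)) (hΩ : s.Ω (k + 1) = ∅)
    (t : Sect2.TermValues (F.P p.K) (MatA N) (FluctV N) θ.τ9.M) (ht : IsFluctLocal k t) (E₀ : ℝ)
    (hid : slotsOfRecord F N θ.ν θ.τ9 (EOfRecord₁₃ F N θ.toStage13Params) (wOfRecord₉ F N θ.toStage9Params) θ.ppSel p
        (gOfRecord₁₃ F N θ.toStage13Params p) k s.init = 0 ∨
      ∀ᵐ U₀ ∂fieldMeasure (F.P p.K) k (SU N),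
        chiSeqOfRecord F N θ.ν θ.τ9.M (gOfRecord₁₃ F N θ.toStage13Params p) p.K k s.init U₀ ≠ 0 →
          slotsOfRecord F N θ.ν θ.τ9 (EOfRecord₁₃ F N θ.toStage13Params) (wOfRecord₉ F N θ.toStage9Params) θ.ppSel p
              (gOfRecord₁₃ F N θ.toStage13Params p) k s.init U₀ =
            sect2Slot F N (FluctV N) p.K (settingOfRecord₁₃ F N θ.toStage13Params p) (θ.rzAt p s.init) (WtOfRecord₁₃H F N (rePinH θ) p s.init) s.init t E₀
              (UbgOfRecord₁₃CoP F N θ.toStage13Params p k s.init) U₀)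
    (hmB : ∀ S ∈ admSOfRecord F θ.ν θ.τ9.M (gOfRecord₁₃ F N θ.toStage13Params p) p.K k s.init,
      Measurable fun U₀ : GaugeField (F.P p.K) k (SU N) =>
        tkBranchOfRecord F N (FluctV N) θ.ν θ.τ9.M _ p.K (WtOfRecord₁₃H F N (rePinH θ) p s) s.init S k
          (fun ω => sect2Operand F N (FluctV N) p.K (settingOfRecord₁₃ F N θ.toStage13Params p) (θ.rzAt p s.init) s.init t E₀
            (UbgOfRecord₁₃CoP F N θ.toStage13Params p k s.init) (S, fun j => (ω j).2) (fun j => (ω j).1))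
          (baseCfg (V := FluctV N) k U₀))
    (hIB : ∀ S ∈ admSOfRecord F θ.ν θ.τ9.M (gOfRecord₁₃ F N θ.toStage13Params p) p.K k s.init,
      Integrable (fun U₀ : GaugeField (F.P p.K) k (SU N) =>
        tkBranchOfRecord F N (FluctV N) θ.ν θ.τ9.M _ p.K (WtOfRecord₁₃H F N (rePinH θ) p s) s.init S k
          (fun ω => sect2Operand F N (FluctV N) p.K (settingOfRecord₁₃ F N θ.toStage13Params p) (θ.rzAt p s.init) s.init t E₀
            (UbgOfRecord₁₃CoP F N θ.toStage13Params p k s.init) (S, fun j => (ω j).2) (fun j => (ω j).1))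
          (baseCfg (V := FluctV N) k U₀)) (fieldMeasure (F.P p.K) k (SU N))) :
    slotsTOfRecord F N θ.ν θ.τ9 (EOfRecord₁₃ F N θ.toStage13Params) (wOfRecord₉ F N θ.toStage9Params) θ.ppSel p
        (gOfRecord₁₃ F N θ.toStage13Params p) (k + 1) s = 0 ∨
      ∀ᵐ V' ∂fieldMeasure (F.P p.K) (k + 1) (SU N),
        chiSeqOfRecord F N θ.ν θ.τ9.M (gOfRecord₁₃ F N θ.toStage13Params p) p.K (k + 1) s V' ≠ 0 →
          slotsTOfRecord F N θ.ν θ.τ9 (EOfRecord₁₃ F N θ.toStage13Params) (wOfRecord₉ F N θ.toStage9Params) θ.ppSel p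
              (gOfRecord₁₃ F N θ.toStage13Params p) (k + 1) s V' =
            sect2Slot F N (FluctV N) p.K (settingOfRecord₁₃ F N θ.toStage13Params p) (θ.rzAt p s) (WtOfRecord₁₃H F N (rePinH θ) p s) s t E₀
              (UbgOfRecord₁₃CoP F N θ.toStage13Params p (k + 1) s) V' :=
  clause_succ_rePinH_of_Omega_empty_of_oldBranch_of_clause_of_integrable θ p h hk hM s hΩ t E₀
    (fun S a a' Uf ha => action23_sect2ActionDataOfRecord_congr_fluct_of_isFluctLocal p.K _ _ s.init ht E₀ S a a' ha Uf) hid hmB hIB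

/-- **★★★ THE GENERAL-HISTORY NO-EXPANSION 𝐓-STEP AT `rePinH θ` WITH NO LOCALITY BINDER, PER WITNESS**: for ANY term values `t` and constant `E₀` carrying the level-`k`
§2 identity at `init s′` (`hid`, for `t` itself), the 𝐓-image clause at `s′` holds for the TRUNCATED family `truncTermValues k t` — provided the old branches OF THAT
FAMILY are measurable and `dU_k`-integrable.  (hA) of p569094 is gone: the identity transfers to the truncated family by `sect2Slot_truncTermValues` (nothing `𝐓_k`
reads changes) and the truncated family is `k`-local by construction.  No binder quantifies over all term families. [cite: Balaban1988Convergent, Theorem p.245, Thm 1 p.262, (3.24)–(3.25) p.270, (2.23) p.258, (2.40)–(2.41) p.261] -/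
theorem clause_succ_rePinH_truncTermValues_of_Omega_empty_of_clause_of_integrable (h : θ.Provisos₁₃CoPH F N) {k : ℕ} (hk : k < p.K) (hM : 1 ≤ θ.τ9.M)
    (s : SeqOfRecord F θ.ν θ.τ9.M (gOfRecord₁₃ F N θ.toStage13Params p) p.K (k + 1)) (hΩ : s.Ω (k + 1) = ∅)
    (t : Sect2.TermValues (F.P p.K) (MatA N) (FluctV N) θ.τ9.M) (E₀ : ℝ)
    (hid : slotsOfRecord F N θ.ν θ.τ9 (EOfRecord₁₃ F N θ.toStage13Params) (wOfRecord₉ F N θ.toStage9Params) θ.ppSel p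
        (gOfRecord₁₃ F N θ.toStage13Params p) k s.init = 0 ∨
      ∀ᵐ U₀ ∂fieldMeasure (F.P p.K) k (SU N),
        chiSeqOfRecord F N θ.ν θ.τ9.M (gOfRecord₁₃ F N θ.toStage13Params p) p.K k s.init U₀ ≠ 0 →
          slotsOfRecord F N θ.ν θ.τ9 (EOfRecord₁₃ F N θ.toStage13Params) (wOfRecord₉ F N θ.toStage9Params) θ.ppSel p
              (gOfRecord₁₃ F N θ.toStage13Params p) k s.init U₀ =
            sect2Slot F N (FluctV N) p.K (settingOfRecord₁₃ F N θ.toStage13Params p) (θ.rzAt p s.init) (WtOfRecord₁₃H F N (rePinH θ) p s.init) s.init t E₀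
              (UbgOfRecord₁₃CoP F N θ.toStage13Params p k s.init) U₀)
    (hmB : ∀ S ∈ admSOfRecord F θ.ν θ.τ9.M (gOfRecord₁₃ F N θ.toStage13Params p) p.K k s.init,
      Measurable fun U₀ : GaugeField (F.P p.K) k (SU N) =>
        tkBranchOfRecord F N (FluctV N) θ.ν θ.τ9.M _ p.K (WtOfRecord₁₃H F N (rePinH θ) p s) s.init S k
          (fun ω => sect2Operand F N (FluctV N) p.K (settingOfRecord₁₃ F N θ.toStage13Params p) (θ.rzAt p s.init) s.init (truncTermValues k t) E₀
            (UbgOfRecord₁₃CoP F N θ.toStage13Params p k s.init) (S, fun j => (ω j).2) (fun j => (ω j).1))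
          (baseCfg (V := FluctV N) k U₀))
    (hIB : ∀ S ∈ admSOfRecord F θ.ν θ.τ9.M (gOfRecord₁₃ F N θ.toStage13Params p) p.K k s.init,
      Integrable (fun U₀ : GaugeField (F.P p.K) k (SU N) =>
        tkBranchOfRecord F N (FluctV N) θ.ν θ.τ9.M _ p.K (WtOfRecord₁₃H F N (rePinH θ) p s) s.init S k
          (fun ω => sect2Operand F N (FluctV N) p.K (settingOfRecord₁₃ F N θ.toStage13Params p) (θ.rzAt p s.init) s.init (truncTermValues k t) E₀
            (UbgOfRecord₁₃CoP F N θ.toStage13Params p k s.init) (S, fun j => (ω j).2) (fun j => (ω j).1))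
          (baseCfg (V := FluctV N) k U₀)) (fieldMeasure (F.P p.K) k (SU N))) :
    slotsTOfRecord F N θ.ν θ.τ9 (EOfRecord₁₃ F N θ.toStage13Params) (wOfRecord₉ F N θ.toStage9Params) θ.ppSel p
        (gOfRecord₁₃ F N θ.toStage13Params p) (k + 1) s = 0 ∨
      ∀ᵐ V' ∂fieldMeasure (F.P p.K) (k + 1) (SU N),
        chiSeqOfRecord F N θ.ν θ.τ9.M (gOfRecord₁₃ F N θ.toStage13Params p) p.K (k + 1) s V' ≠ 0 →
          slotsTOfRecord F N θ.ν θ.τ9 (EOfRecord₁₃ F N θ.toStage13Params) (wOfRecord₉ F N θ.toStage9Params) θ.ppSel p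
              (gOfRecord₁₃ F N θ.toStage13Params p) (k + 1) s V' =
            sect2Slot F N (FluctV N) p.K (settingOfRecord₁₃ F N θ.toStage13Params p) (θ.rzAt p s) (WtOfRecord₁₃H F N (rePinH θ) p s) s
              (truncTermValues k t) E₀ (UbgOfRecord₁₃CoP F N θ.toStage13Params p (k + 1) s) V' := by
  refine clause_succ_rePinH_of_Omega_empty_of_isFluctLocal_of_clause_of_integrable θ p h hk hM s hΩ (truncTermValues k t)
    (isFluctLocal_truncTermValues k t) E₀ ?_ hmB hIB
  rw [sect2Slot_truncTermValues p.K _ _ _ (Nat.le_succ k)]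
  exact hid

/-- **★★★ THE OFF-DIAGONAL RESIDUE OF N11's NO-EXPANSION 𝐓-STEP, `SLaw`-KEYED, (hA) ELIMINATED, WITNESS FIRST**: from `SLaw₁₃CoPH (rePinH θ) p k` one obtains term-value
and constant FAMILIES `(t, E_k)` — universal in `𝐄`, every member `k`-LOCAL and obeying the inductive laws `Sect2.LawsRT … k` on its own tower, carrying the level-`k`
§2 dichotomy of `ρ_k` at every history — such that for EVERY history `s′` with `Ω_{k+1}(s′) = ∅` the 𝐓-image clause at `s′` holds for `(t (init s′), E_k(init s′))`
as soon as the old branches OF THAT WITNESS are measurable and `dU_k`-integrable.  The two remaining binders are properties of the produced witness, stated after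
it (no hypothesis quantifies over all term families); both hold on the all-large diagonal (p556687, p563687). [cite: Balaban1988Convergent, Theorem p.245, Thm 1 p.262, (3.24)–(3.25) p.270, (2.18) p.257, (2.23) p.258, (2.40)–(2.41) p.261] -/
theorem exists_local_witness_clause_succ_rePinH_of_sLaw₁₃CoPH (h : θ.Provisos₁₃CoPH F N) {k : ℕ} (hk : k < p.K) (hM : 1 ≤ θ.τ9.M)
    (hS : SLaw₁₃CoPH F N (rePinH θ) p k) :
    ∃ (t : SeqOfRecord F θ.ν θ.τ9.M (gOfRecord₁₃ F N θ.toStage13Params p) p.K k → Sect2.TermValues (F.P p.K) (MatA N) (FluctV N) θ.τ9.M)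
      (Ek : SeqOfRecord F θ.ν θ.τ9.M (gOfRecord₁₃ F N θ.toStage13Params p) p.K k → ℝ),
      HasSect2FormAtZS F N (FluctV N) p.K (settingOfRecord₁₃ F N θ.toStage13Params p) k (θ.rzAt p) (WtOfRecord₁₃H F N (rePinH θ) p)
          (UbgOfRecord₁₃CoP F N θ.toStage13Params p k)
          (fun s₀ t₀ => Sect2.LawsRT (sect2TowerOfRecord F N (FluctV N) p.K (settingOfRecord₁₃ F N θ.toStage13Params p) (θ.rzAt p s₀) s₀ t₀)
            (settingOfRecord₁₃ F N θ.toStage13Params p).lf k)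
          (slotsOfRecord F N θ.ν θ.τ9 (EOfRecord₁₃ F N θ.toStage13Params) (wOfRecord₉ F N θ.toStage9Params) θ.ppSel p
            (gOfRecord₁₃ F N θ.toStage13Params p) k) t Ek ∧
      (∀ s₀, IsFluctLocal k (t s₀)) ∧
      ∀ (s : SeqOfRecord F θ.ν θ.τ9.M (gOfRecord₁₃ F N θ.toStage13Params p) p.K (k + 1)), s.Ω (k + 1) = ∅ →
        (∀ S ∈ admSOfRecord F θ.ν θ.τ9.M (gOfRecord₁₃ F N θ.toStage13Params p) p.K k s.init,
          Measurable fun U₀ : GaugeField (F.P p.K) k (SU N) =>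
            tkBranchOfRecord F N (FluctV N) θ.ν θ.τ9.M _ p.K (WtOfRecord₁₃H F N (rePinH θ) p s) s.init S k
              (fun ω => sect2Operand F N (FluctV N) p.K (settingOfRecord₁₃ F N θ.toStage13Params p) (θ.rzAt p s.init) s.init (t s.init) (Ek s.init)
                (UbgOfRecord₁₃CoP F N θ.toStage13Params p k s.init) (S, fun j => (ω j).2) (fun j => (ω j).1))
              (baseCfg (V := FluctV N) k U₀)) →
        (∀ S ∈ admSOfRecord F θ.ν θ.τ9.M (gOfRecord₁₃ F N θ.toStage13Params p) p.K k s.init,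
          Integrable (fun U₀ : GaugeField (F.P p.K) k (SU N) =>
            tkBranchOfRecord F N (FluctV N) θ.ν θ.τ9.M _ p.K (WtOfRecord₁₃H F N (rePinH θ) p s) s.init S k
              (fun ω => sect2Operand F N (FluctV N) p.K (settingOfRecord₁₃ F N θ.toStage13Params p) (θ.rzAt p s.init) s.init (t s.init) (Ek s.init)
                (UbgOfRecord₁₃CoP F N θ.toStage13Params p k s.init) (S, fun j => (ω j).2) (fun j => (ω j).1))
              (baseCfg (V := FluctV N) k U₀)) (fieldMeasure (F.P p.K) k (SU N))) →
        (slotsTOfRecord F N θ.ν θ.τ9 (EOfRecord₁₃ F N θ.toStage13Params) (wOfRecord₉ F N θ.toStage9Params) θ.ppSel p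
            (gOfRecord₁₃ F N θ.toStage13Params p) (k + 1) s = 0 ∨
          ∀ᵐ V' ∂fieldMeasure (F.P p.K) (k + 1) (SU N),
            chiSeqOfRecord F N θ.ν θ.τ9.M (gOfRecord₁₃ F N θ.toStage13Params p) p.K (k + 1) s V' ≠ 0 →
              slotsTOfRecord F N θ.ν θ.τ9 (EOfRecord₁₃ F N θ.toStage13Params) (wOfRecord₉ F N θ.toStage9Params) θ.ppSel p
                  (gOfRecord₁₃ F N θ.toStage13Params p) (k + 1) s V' =
                sect2Slot F N (FluctV N) p.K (settingOfRecord₁₃ F N θ.toStage13Params p) (θ.rzAt p s) (WtOfRecord₁₃H F N (rePinH θ) p s) s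
                  (t s.init) (Ek s.init) (UbgOfRecord₁₃CoP F N θ.toStage13Params p (k + 1) s) V') := by
  obtain ⟨t, Ek, hform, hloc⟩ := (sLaw₁₃CoPH_iff_exists_local (rePinH θ) p k).1 hS
  exact ⟨t, Ek, hform, hloc, fun s hΩ hmB hIB =>
    clause_succ_rePinH_of_Omega_empty_of_isFluctLocal_of_clause_of_integrable θ p h hk hM s hΩ (t s.init) (hloc s.init) (Ek s.init)
      (hform.2 s.init).2 hmB hIB⟩

end RePinned

end Summit.QuantumFields.YangMills.Theorems.BalabanUVNodesN11FluctTruncation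

end
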